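import Mathlib
import HarnessLib
import Summits.ValiantsHypothesis.ValiantsHypothesis.Theses.MonotoneRestoration
import Literature.Computability.AlgebraicComplexity.ArithCircuit
import Literature.Computability.AlgebraicComplexity.ArithCircuitProofs
import Literature.Computability.AlgebraicComplexity.MonotoneStructure
import Literature.Computability.AlgebraicComplexity.PermanentIrreducible
import Literature.ModelTheory.FiniteModelTheory.CkEquiv
import Summits.ValiantsHypothesis.ValiantsHypothesis.Theorems.MonotoneRestorationMonotoneRestorationQPCosetCount
import Summits.ValiantsHypothesis.ValiantsHypothesis.Theorems.MonotoneRestorationMonotoneRestorationQPSymmetricLB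
import Summits.ValiantsHypothesis.ValiantsHypothesis.Theorems.MonotoneRestorationMonotoneRestorationQPSupportSymmetrisation
import Summits.ValiantsHypothesis.ValiantsHypothesis.Theorems.MonotoneRestorationMonotoneRestorationQPSparseRegime
import Summits.ValiantsHypothesis.ValiantsHypothesis.Theorems.MonotoneRestorationMonotoneRestorationQPBeta
import Literature.Computability.AlgebraicComplexity.SymmetricArithCircuit
import Literature.Computability.AlgebraicComplexity.DawarWilsenach2025Proofs
import Literature.GroupTheory.PermutationGroups.SmallIndexSubgroups
import Summits.ValiantsHypothesis.ValiantsHypothesis.Theorems.MonotoneRestorationQP.Negative.LoadBearing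
import Summits.ValiantsHypothesis.ValiantsHypothesis.Theorems.MonotoneRestorationMonotoneRestorationQPPermSupportCount
import Summits.ValiantsHypothesis.ValiantsHypothesis.Theorems.MonotoneRestorationMonotoneRestorationQPMulGateChildren

/-! TTRL-lite variant V18949 of stmt-ValiantsHypothesis-15886 -/

-- `ValiantsHypothesis.ValiantsHypothesis`: the D-0017 layout repeats the problem name in the path.
set_option linter.dupNamespace false

namespace Summit.ValiantsHypothesis.ValiantsHypothesis.Theorems

open Summit.ValiantsHypothesis.ValiantsHypothesis.Theses.MonotoneRestoration
open Literature.Computability.AlgebraicComplexity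

/-- **Children of a nonzero `×` gate extending into a row-multilinear `f` are row-multilinear**
(TTRL-lite variant V18949 of `stub_mulGate_children_extend`, stmt-ValiantsHypothesis-15886).
Over `ℝ≥0` nothing cancels: if `P` is a nonzero `×` gate whose monomials extend by a common shift
`μ` to monomials of `f`, then every monomial `m` of a child `h` extends by some shift `μ'` to a
monomial `m + μ'` of `f` (G3, `stub_mulGate_children_extend`); if every monomial of `f` has all
row degrees `≤ 1`, additivity of `rowDegrees` gives `rowDegrees m i ≤ rowDegrees (m + μ') i ≤ 1`
for every row `i`. [folklore] -/
theorem stub_mulGate_children_extend_var18949 :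
    ∀ (n : ℕ) (G : Type) (C : LabelledArithCircuit NNReal (Fin n × Fin n) Unit G)
      (f : MvPolynomial (Fin n × Fin n) NNReal) (P : G), C.label P = .mul → C.eval P ≠ 0 →
      (∃ μ : (Fin n × Fin n) →₀ ℕ, ∀ m ∈ (C.eval P).support, m + μ ∈ f.support) →
      (∀ m ∈ f.support, ∀ i : Fin n, rowDegrees m i ≤ 1) →
      ∀ h ∈ C.children P, ∀ m ∈ (C.eval h).support, ∀ i : Fin n, rowDegrees m i ≤ 1 := by
  intro n G C f P hP hP0 hext hrow h hh m hm i
  obtain ⟨μ, hμ⟩ := (stub_mulGate_children_extend C f hP hP0 hext).1 h hh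
  have h1 := hrow _ (hμ m hm) i
  simp only [rowDegrees_add, Finsupp.add_apply] at h1
  omega

end Summit.ValiantsHypothesis.ValiantsHypothesis.Theorems
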